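import Mathlib

/-!
# Route `FilamentSkeletonRss` · crux `SelectionBoxRJ` (stmt-NavierStokesRegularity-21220) — rung tools:
# near-straight curves are globally chord-arc

Lane `ns-filament-19175-p1` (g6); removes the chord-arc hypothesis of the near-straight local-induction bricks
(`nearStraight_selfInductionTail`, `nearStraight_liaReduction`) for the in-ball arcs of the box continued by straight
rays (memo `SIGMA-SCALING-21220.md`, §5).  Helper file `--supports stmt-NavierStokesRegularity-21220`; Mathlib only.

* `inner_chord_ge_of_nearStraight` — if `X` is `C¹` and `‖X′(v) − a‖ ≤ θ` for all `v`, with `‖a‖ = 1`, then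
  `⟪X u − X t, a⟫ ≥ (1 − θ)(u − t)` for `t ≤ u` (the velocity has component `≥ 1 − θ` along `a`).
* `chordArc_of_nearStraight` — hence `(1 − θ)|u − t| ≤ ‖X u − X t‖` for all `u, t`: a near-straight curve is
  chord-arc with the GLOBAL constant `c = 1 − θ` (useful for `θ < 1`; the box's clause 4 only gives `cg` at scales
  `≥ ρ√Γ`).  In the box scaling `θ = O(Rb²)` (`…RungBending`), so `c ≥ 1/2` for small `Rb`, uniformly in `Γ`.

HONEST FRAMING.  Elementary geometry for the rung ladder of a HYPOTHETICAL filament box; nothing here is a claim about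
Navier–Stokes regularity or blow-up.
-/

set_option linter.dupNamespace false

noncomputable section

namespace Summit.NavierStokesRegularity.NavierStokesRegularity.Theorems

open Set
open scoped InnerProductSpace

namespace SelectionBoxRJRung

/-- **Forward progress of a near-straight curve.** If `X : ℝ → E` is `C¹` with `‖X′(v) − a‖ ≤ θ` for all `v`
(`‖a‖ = 1`), then `⟪X u − X t, a⟫ ≥ (1 − θ)(u − t)` whenever `t ≤ u`. [folklore] -/
theorem inner_chord_ge_of_nearStraight {E : Type*} [NormedAddCommGroup E] [InnerProductSpace ℝ E]
    {X : ℝ → E} {a : E} {θ : ℝ} (hX : ContDiff ℝ 1 X) (ha : ‖a‖ = 1)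
    (hθ : ∀ v, ‖deriv X v - a‖ ≤ θ) {t u : ℝ} (htu : t ≤ u) :
    (1 - θ) * (u - t) ≤ ⟪X u - X t, a⟫_ℝ := by
  have hXd : Differentiable ℝ X := hX.differentiable (by norm_num)
  -- `φ v = ⟪X v, a⟫ − (1 − θ) v` is monotone
  set φ : ℝ → ℝ := fun v => ⟪X v, a⟫_ℝ - (1 - θ) * v with hφ
  have hφd : ∀ v, HasDerivAt φ (⟪deriv X v, a⟫_ℝ - (1 - θ)) v := by
    intro v
    have h1 : HasDerivAt (fun v => ⟪X v, a⟫_ℝ) (⟪X v, (0 : E)⟫_ℝ + ⟪deriv X v, a⟫_ℝ) v :=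
      (hXd v).hasDerivAt.inner ℝ (hasDerivAt_const v a)
    rw [inner_zero_right, zero_add] at h1
    have h2 : HasDerivAt (fun v : ℝ => (1 - θ) * v) (1 - θ) v := by
      simpa using (hasDerivAt_id v).const_mul (1 - θ)
    exact h1.sub h2
  have hφ' : ∀ v, 0 ≤ deriv φ v := by
    intro v
    rw [(hφd v).deriv]
    -- `⟪X′ v, a⟫ = ⟪a, a⟫ + ⟪X′ v − a, a⟫ ≥ 1 − θ`
    have hsplit : ⟪deriv X v, a⟫_ℝ = ⟪a, a⟫_ℝ + ⟪deriv X v - a, a⟫_ℝ := by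
      rw [← inner_add_left, add_sub_cancel]
    have haa : ⟪a, a⟫_ℝ = 1 := by rw [real_inner_self_eq_norm_sq, ha, one_pow]
    have hcs : |⟪deriv X v - a, a⟫_ℝ| ≤ ‖deriv X v - a‖ * ‖a‖ := abs_real_inner_le_norm _ _
    rw [ha, mul_one] at hcs
    have := neg_abs_le (⟪deriv X v - a, a⟫_ℝ)
    linarith [hθ v]
  have hmono : Monotone φ := monotone_of_deriv_nonneg (fun v => (hφd v).differentiableAt) hφ'
  have h := hmono htu
  simp only [hφ] at h
  rw [inner_sub_left]
  linarith

/-- **Near-straight curves are globally chord-arc:** `(1 − θ)|u − t| ≤ ‖X u − X t‖` for all `u, t`, under the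
hypotheses of `inner_chord_ge_of_nearStraight`. [folklore] -/
theorem chordArc_of_nearStraight {E : Type*} [NormedAddCommGroup E] [InnerProductSpace ℝ E]
    {X : ℝ → E} {a : E} {θ : ℝ} (hX : ContDiff ℝ 1 X) (ha : ‖a‖ = 1)
    (hθ : ∀ v, ‖deriv X v - a‖ ≤ θ) (u t : ℝ) :
    (1 - θ) * |u - t| ≤ ‖X u - X t‖ := by
  have key : ∀ t u : ℝ, t ≤ u → (1 - θ) * (u - t) ≤ ‖X u - X t‖ := by
    intro t u htu
    have h1 := inner_chord_ge_of_nearStraight hX ha hθ htu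
    have h2 : ⟪X u - X t, a⟫_ℝ ≤ ‖X u - X t‖ := by
      have := real_inner_le_norm (X u - X t) a
      rwa [ha, mul_one] at this
    exact h1.trans h2
  rcases le_total t u with htu | hut
  · rw [abs_of_nonneg (sub_nonneg.2 htu)]
    exact key t u htu
  · rw [abs_of_nonpos (sub_nonpos.2 hut), neg_sub, norm_sub_rev]
    exact key u t hut

end SelectionBoxRJRung

end Summit.NavierStokesRegularity.NavierStokesRegularity.Theorems
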